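import Mathlib.AlgebraicGeometry.ProjectiveSpectrum.Basic
import Mathlib.AlgebraicGeometry.AffineScheme
import Mathlib.Topology.JacobsonSpace
import HarnessLib

/-!
# A closed point of one chart of `Proj A` as a blow-up centre

Support file for crux stmt-ResolutionOfSingularities-15315
(`FrobeniusLadder.FInjectiveMacaulayfication`, line `Sketch`, seat c6): stub
`stub_projChartPointCentre`.

In the crux's tower of blow-ups the second centre is a maximal ideal `q₀` of ONE chart ring
`(A_f)₀ = HomogeneousLocalization.Away 𝒜 f` of `X₁ = Proj A`, transported to the ring of
sections `Γ(X₁, D₊(f))` along a ring isomorphism `e : Γ(Proj A, D₊(f)) ≃+* (A_f)₀` that is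
compatible with `primeIdealOf` (for every prime `q` of `(A_f)₀`, the point `awayι q` of `D₊(f)`
has `primeIdealOf = e⁻¹(q)`; such an `e` exists by the sibling file
`FrobeniusLadderFInjectiveMacaulayficationProjBasicOpenSections`, and here it is a hypothesis).
This file records the three facts the tower step consumes about the point `b := awayι q₀`:

1. `b ∈ D₊(f)` (the image of the chart `awayι : Spec (A_f)₀ ⟶ Proj A` is `D₊(f)`);
2. for `y ∈ D₊(f)`: `e⁻¹(q₀) ≤ primeIdealOf y ↔ y = b` (write `y = awayι q`; then
   `primeIdealOf y = e⁻¹(q)`, `e⁻¹(q₀) ≤ e⁻¹(q) ↔ q₀ ≤ q`, and `q₀` maximal, `q` proper force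
   `q = q₀`; conversely `awayι` is injective);
3. if `Proj A` is a Jacobson space then `{b}` is closed: `{q₀}` is closed in `Spec (A_f)₀`
   (`q₀` is maximal) and an open embedding into a Jacobson space pulls the closed points back
   to exactly the closed points (`Topology.IsOpenEmbedding.preimage_closedPoints`).

References: The Stacks Project, Tag 01MB (`D₊(f) ≅ Spec A_(f)` for `Proj`) and Tag 005X
(closed points of opens of Jacobson spaces). [StacksProject]
Everything here is folklore bookkeeping over Mathlib's `AlgebraicGeometry.Proj` and
`JacobsonSpace` API; no definition is declared.
-/

-- single-problem summit: the doubled namespace component `ResolutionOfSingularities` is forced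
set_option linter.dupNamespace false

noncomputable section

namespace Summit.ResolutionOfSingularities.ResolutionOfSingularities.Theorems.FInjectiveMacaulayfication.ProjChartPointCentre

open AlgebraicGeometry CategoryTheory

/-- Every point of the chart `Spec (A_f)₀` lands in `D₊(f)` under `awayι` (the image of the
open immersion `awayι` is `D₊(f)`). [cite: StacksProject, Tag 01MB] -/
theorem awayι_apply_mem {R A : Type} [CommRing R] [CommRing A] [Algebra R A]
    (𝒜 : ℕ → Submodule R A) [GradedAlgebra 𝒜] (f : A) {m : ℕ} (hf : f ∈ 𝒜 m) (hm : 0 < m)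
    (q : PrimeSpectrum (HomogeneousLocalization.Away 𝒜 f)) :
    (Proj.awayι 𝒜 f hf hm).base q ∈ Proj.basicOpen 𝒜 f := by
  rw [← Proj.opensRange_awayι 𝒜 f hf hm]
  exact ⟨q, rfl⟩

/-- Every point of `D₊(f)` is the image under `awayι` of a point of the chart `Spec (A_f)₀`
(the image of the open immersion `awayι` is `D₊(f)`). [cite: StacksProject, Tag 01MB] -/
theorem exists_awayι_apply_eq {R A : Type} [CommRing R] [CommRing A] [Algebra R A]
    (𝒜 : ℕ → Submodule R A) [GradedAlgebra 𝒜] (f : A) {m : ℕ} (hf : f ∈ 𝒜 m) (hm : 0 < m)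
    {y : Proj 𝒜} (hy : y ∈ Proj.basicOpen 𝒜 f) :
    ∃ q : PrimeSpectrum (HomogeneousLocalization.Away 𝒜 f), (Proj.awayι 𝒜 f hf hm).base q = y := by
  rw [← Proj.opensRange_awayι 𝒜 f hf hm] at hy
  exact hy

/-- **A closed point of one chart of `Proj A` as a centre.** Let `f` be homogeneous of positive
degree, `e : Γ(Proj A, D₊(f)) ≃+* (A_f)₀` a ring isomorphism compatible with `primeIdealOf`
along the chart `awayι : Spec (A_f)₀ ⟶ Proj A`, and `q₀` a maximal ideal of `(A_f)₀`. Then the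
point `b = awayι q₀` lies in `D₊(f)`; a point `y ∈ D₊(f)` satisfies `e⁻¹(q₀) ≤ primeIdealOf y`
iff `y = b`; and if `Proj A` is a Jacobson space then `{b}` is closed in `Proj A`.
[cite: StacksProject, Tag 01MB] -/
theorem stub_projChartPointCentre : ∀ (R A : Type) [CommRing R] [CommRing A] [Algebra R A]
    (𝒜 : ℕ → Submodule R A) [GradedAlgebra 𝒜] (f : A) (m : ℕ) (hf : f ∈ 𝒜 m) (hm : 0 < m)
    (e : Γ(Proj 𝒜, Proj.basicOpen 𝒜 f) ≃+* HomogeneousLocalization.Away 𝒜 f),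
    (∀ (y : Proj.basicOpen 𝒜 f) (q : PrimeSpectrum (HomogeneousLocalization.Away 𝒜 f)),
        (Proj.awayι 𝒜 f hf hm).base q = y.1 →
        ((Proj.isAffineOpen_basicOpen 𝒜 f hf hm).primeIdealOf y).asIdeal = q.asIdeal.comap e.toRingHom) →
    ∀ (q₀ : PrimeSpectrum (HomogeneousLocalization.Away 𝒜 f)), q₀.asIdeal.IsMaximal →
      (Proj.awayι 𝒜 f hf hm).base q₀ ∈ Proj.basicOpen 𝒜 f ∧
      (∀ (y : Proj 𝒜) (hy : y ∈ Proj.basicOpen 𝒜 f),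
        Ideal.comap e.toRingHom q₀.asIdeal ≤
            ((Proj.isAffineOpen_basicOpen 𝒜 f hf hm).primeIdealOf ⟨y, hy⟩).asIdeal ↔
          y = (Proj.awayι 𝒜 f hf hm).base q₀) ∧
      (JacobsonSpace ↥(Proj 𝒜) → IsClosed ({(Proj.awayι 𝒜 f hf hm).base q₀} : Set ↥(Proj 𝒜))) := by
  intro R A _ _ _ 𝒜 _ f m hf hm e he q₀ hq₀
  refine ⟨awayι_apply_mem 𝒜 f hf hm q₀, fun y hy => ?_, fun hJ => ?_⟩
  · -- write `y = awayι q`; then `primeIdealOf y = e⁻¹(q)` by the compatibility hypothesis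
    obtain ⟨q, rfl⟩ := exists_awayι_apply_eq 𝒜 f hf hm hy
    rw [he ⟨_, hy⟩ q rfl, Ideal.comap_le_comap_iff_of_surjective e.toRingHom e.surjective]
    constructor
    · -- `q₀ ≤ q` with `q₀` maximal and `q` proper forces `q = q₀`
      intro h
      rw [PrimeSpectrum.ext (hq₀.eq_of_le q.isPrime.ne_top h).symm]
    · -- `awayι` is injective
      intro h
      rw [(Proj.awayι 𝒜 f hf hm).isOpenEmbedding.injective h]
  · -- `{q₀}` is closed in `Spec (A_f)₀`, and the open embedding `awayι` into the Jacobson space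
    -- `Proj A` pulls the closed points of `Proj A` back to exactly the closed points of the chart
    have hq₀' : q₀ ∈ closedPoints (PrimeSpectrum (HomogeneousLocalization.Away 𝒜 f)) :=
      (PrimeSpectrum.isClosed_singleton_iff_isMaximal q₀).mpr hq₀
    have hpre : q₀ ∈ (Proj.awayι 𝒜 f hf hm).base ⁻¹' closedPoints ↥(Proj 𝒜) := by
      rw [(Proj.awayι 𝒜 f hf hm).isOpenEmbedding.preimage_closedPoints]
      exact hq₀'
    exact hpre

end Summit.ResolutionOfSingularities.ResolutionOfSingularities.Theorems.FInjectiveMacaulayfication.ProjChartPointCentre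

end
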